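import Mathlib
import HarnessLib
import Summits.HubbardSuperconductivity.HubbardSuperconductivity.Theorems.KLProgrammeKLRegimeEngineLastStepResponseBracketFlowFinalPos
import Summits.HubbardSuperconductivity.HubbardSuperconductivity.Theorems.KLProgrammeKLRegimeEngineLastRespMarginE1Half
import Summits.HubbardSuperconductivity.HubbardSuperconductivity.Theorems.KLProgrammeKLRegimeFlowReadPrivSwapLit

/-!
# K3 gen-8-FLOW (stmt 20437, stub (C), located item #20, cure (δ′) «LAST-STEP SWAP», layer F3k″): THE LAST-INDEX TWO-LEG READING, ONE CALL, E1 SIDE = FOUR NUMBERS —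
# `twoLegRead_flow_last_registered_of_pos` (cell gate-hubbard-kl, seat p2 g21)

= k3c3-p1's (P)-receiver `twoLegRead_flow_succ_of_swap_lit_registered` at `n := n_β` ∘ the (δ′) door in position currency `lastResponse_bracket_flow_final_pos` (p648293)
∘ the margin lemmas `lastResp_hZtU_of_le_klLastRespU` (p638605), `lastResp_hCU_pos_of_le`, `lastResp_hZb/hZc_of_le` (p649349).  Compared with
`twoLegRead_flow_last_registered_of_door_graded` (p646819) the E1 side is now: the four PINNED POSITION-NORM TABLES of `W₂[𝒱^{(N+1)}[K_{N+1}]]` bounded DIRECTLY by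
`cb·U·(4^N)^m` (m ≤ 4), `cbs·U·(4^N)^s`, `cc·U²·(4^N)^m`, `ccs·U²·(4^N)^s` (β-free constants `cb cbs cc ccs ≥ 0` — all that E1 owes at the last index), and TWO
U-rows: `U ≤ klLastRespU P R` (AMENDMENT 19) and the explicit E1 row `32·klEngRsq R⁵·(2^234·cb + 2^156·cc + cbs + ccs)·U ≤ 1`; no `Zb/Zc/Nm/Ns/hZtU/hCU` binders remain.
Everything else verbatim: regime, engine history + closed envelopes, `hL : klEngL₄ ≤ L`, `hZn`, `10 ≤ s`, the volume guard `4·klFlowDeg(n_β+1) ≤ L`, and the closer-side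
brackets (A) `hA/hAval`, (T) `hTr/hTrdiff`, (C1) `hJ/hJdiff` with `eT 0 = eJ 0 = 0` and the three fits.

* **`twoLegRead_flow_last_registered_of_pos`**.

Composition only; no definitions; nothing asserts superconductivity.  Refs: BGM 2006 §2.4 Lemma 2.1 (2.36)–(2.42) [cite: BenfattoGiulianiMastropietro2006];
FST 1996 §1 [cite: FeldmanSalmhoferTrubowitz1996].
-/

noncomputable section

namespace Summit.HubbardSuperconductivity.HubbardSuperconductivity.Theorems.EngineV8

set_option linter.dupNamespace false -- summit = problem name (single-conjunct summit), D-0017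
set_option exponentiation.threshold 512 -- the graded alias-tail constant is `2^282`

open Complex Real Finset Filter Literature.MathematicalPhysics.QuantumLattice Literature.Probability.LatticeModels
open Literature.MathematicalPhysics.QuantumLattice.BandSectorCounting
open Literature.Analysis.Fourier Literature.Analysis.Calculus
open Summit.HubbardSuperconductivity.HubbardSuperconductivity.Theorems.KLRegimeSplit
open Summit.HubbardSuperconductivity.HubbardSuperconductivity.Theorems.DispersionFlow
open Summit.HubbardSuperconductivity.HubbardSuperconductivity.Theorems.KLProgrammeLegKernels
open Summit.HubbardSuperconductivity.HubbardSuperconductivity.Theorems.PerturbedFermiCurve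
open scoped Nat

section LastOfPos

variable {L M : ℕ} [NeZero L] [NeZero M]

/-- **THE LAST-INDEX REGISTERED TWO-LEG PAIR, ONE CALL, E1 SIDE = FOUR NUMBERS** — see the module docstring. -/
theorem twoLegRead_flow_last_registered_of_pos {R : RenConsts} (hR : ∀ j, 0 ≤ R.Gfr j) {c : ℝ} (hc : 0 < c) (hcle : c ≤ klCurveC3 R)
    {U : ℝ} (hU : 0 < U) (hU1 : U ≤ 1) (hUle : U ≤ klCurveU0 R) {β : ℝ} (hβmin : klBetaMin ≤ β) (hβc : β ≤ Real.exp (c / U ^ 2))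
    {μ : ℝ} (hμ : μ ∈ klWindowC) (hK : FrameOK R U (nScales β) μ (klFlowFrameU L M β U μ (nScales β))) {G : GeoConsts} {Q : EngConsts} (hGS : ∀ k, 0 ≤ G.S k) (hQS : ∀ k, 0 ≤ Q.S' k) (hR0 : 0 < R.Gfr 0)
    (hPh : ∀ m ≤ nScales β, FlowPieceJetsAt L M β U μ R m) (hT : ∀ m ≤ nScales β, TwoLegReadJetsF L M G Q β U μ m) {W Ξ Θ : ℝ}
    (hW : W = curveExtC (klChi2CauchyTab2 4) G.S 1 + curveExtC (klChi2CauchyTab2 4) Q.S' 1 * |U|) (hΞ : Ξ = 2 ^ 10 * (1 + Real.pi ^ 8 * (W * U ^ 2) / 2 ^ 11) + ∑ j ∈ range 5, R.Gfr j)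
    (hΘ : Θ = 1 + ((∑ j ∈ range 5, R.Gfr j) + Real.pi ^ 8 * W / 2 ^ 11) * |U| / R.Gfr 0)
    (hdoor : R.Gfr 0 * |U| + ((∑ j ∈ range 5, R.Gfr j) + Real.pi ^ 8 * W / 2 ^ 11) * U ^ 2 ≤ 1 / 512) {P : SplitConsts} (hL : klEngL₄ P R β U ≤ L)
    (hZn : IsUnit (effPartitionFn ℂ (normalCovariance L M (uvSymbolCT L M β μ (klFlowFrameU L M β U μ (nScales β + 1)) (klScale klE0 (nScales β + 1))))
      (hubbardInteraction L M β U + counterQuadratic L M β (klFlowFrameU L M β U μ (nScales β + 1)))))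
    {s : ℕ} (hs : 10 ≤ s)
    {cb cbs cc ccs : ℝ} (hcb : 0 ≤ cb) (hcbs : 0 ≤ cbs) (hcc : 0 ≤ cc) (hccs : 0 ≤ ccs)
    (hSb : ∀ m ≤ 4, ∀ (σ : Fin 2) (x₀ : SpaceTimeIdx L M), imagTimeWeight β M *
      ∑ x ∈ (univ : Finset (Fin 2 → SpaceTimeIdx L M)).filter (fun x => x 0 = x₀),
        (1 + ((((x 1).2 - (x 0).2) 0).valMinAbs.natAbs : ℝ) + ((((x 1).2 - (x 0).2) 1).valMinAbs.natAbs : ℝ)) ^ m *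
          ‖sectorisedKernel L M β (trivialMultiplier L M) (klEffectiveAction L M β U μ (klFlowFrameU L M β U μ (nScales β + 1)) klE0 (nScales β + 1)) 2
            (![((0, σ), 0), ((0, σ), 1)] : Fin 2 → SectorLeg 1) x‖ ≤ cb * U * ((4 : ℝ) ^ nScales β) ^ m)
    (hSbs : ∀ (σ : Fin 2) (x₀ : SpaceTimeIdx L M), imagTimeWeight β M *
      ∑ x ∈ (univ : Finset (Fin 2 → SpaceTimeIdx L M)).filter (fun x => x 0 = x₀),
        (1 + ((((x 1).2 - (x 0).2) 0).valMinAbs.natAbs : ℝ) + ((((x 1).2 - (x 0).2) 1).valMinAbs.natAbs : ℝ)) ^ s *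
          ‖sectorisedKernel L M β (trivialMultiplier L M) (klEffectiveAction L M β U μ (klFlowFrameU L M β U μ (nScales β + 1)) klE0 (nScales β + 1)) 2
            (![((0, σ), 0), ((0, σ), 1)] : Fin 2 → SectorLeg 1) x‖ ≤ cbs * U * ((4 : ℝ) ^ nScales β) ^ s)
    (hTc : ∀ m ≤ 4, ∀ (σ : Fin 2) (x₀ : SpaceTimeIdx L M), imagTimeWeight β M *
      ∑ x ∈ (univ : Finset (Fin 2 → SpaceTimeIdx L M)).filter (fun x => x 0 = x₀),
        (1 + ((((x 1).2 - (x 0).2) 0).valMinAbs.natAbs : ℝ) + ((((x 1).2 - (x 0).2) 1).valMinAbs.natAbs : ℝ)) ^ m * (imagTimeWeight β M * (circDist (2 * M) (x 0).1.val (x 1).1.val : ℝ)) *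
          ‖sectorisedKernel L M β (trivialMultiplier L M) (klEffectiveAction L M β U μ (klFlowFrameU L M β U μ (nScales β + 1)) klE0 (nScales β + 1)) 2
            (![((0, σ), 0), ((0, σ), 1)] : Fin 2 → SectorLeg 1) x‖ ≤ cc * U ^ 2 * ((4 : ℝ) ^ nScales β) ^ m)
    (hTcs : ∀ (σ : Fin 2) (x₀ : SpaceTimeIdx L M), imagTimeWeight β M *
      ∑ x ∈ (univ : Finset (Fin 2 → SpaceTimeIdx L M)).filter (fun x => x 0 = x₀),
        (1 + ((((x 1).2 - (x 0).2) 0).valMinAbs.natAbs : ℝ) + ((((x 1).2 - (x 0).2) 1).valMinAbs.natAbs : ℝ)) ^ s * (imagTimeWeight β M * (circDist (2 * M) (x 0).1.val (x 1).1.val : ℝ)) *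
          ‖sectorisedKernel L M β (trivialMultiplier L M) (klEffectiveAction L M β U μ (klFlowFrameU L M β U μ (nScales β + 1)) klE0 (nScales β + 1)) 2
            (![((0, σ), 0), ((0, σ), 1)] : Fin 2 → SectorLeg 1) x‖ ≤ ccs * U ^ 2 * ((4 : ℝ) ^ nScales β) ^ s)
    (hUlast : U ≤ klLastRespU P R) (hUE1 : 32 * klEngRsq R ^ 5 * (2 ^ 234 * cb + 2 ^ 156 * cc + cbs + ccs) * U ≤ 1)
    -- the (P)-receiver's other inputs at the last index (k3c3-p1 `twoLegRead_flow_succ_of_swap_lit_registered`, n := n_β)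
    (hLdeg : 4 * klFlowDeg (nScales β + 1) ≤ L) {cA cA' eT eT' eJ eJ' : ℕ → ℝ} {τA a : ℝ}
    (hA : TwoLegCurveJetBound L M cA cA' β U μ (klFlowFrameU L M β U μ (nScales β)) (nScales β + 1))
    (hAval : ∀ θ : ℝ, |klTwoLegCurveProfile L M β U μ (klFlowFrameU L M β U μ (nScales β)) (nScales β + 1) θ - τA| ≤
      a * U ^ 2 * (4 : ℝ) ^ (-2 * ((nScales β + 1 : ℕ) : ℤ)))
    (hTrdiff : ContDiff ℝ 4 fun θ : ℝ =>
      ((symInterp L (klLocSelfEnergyRe L M β U μ (klFlowFrameU L M β U μ (nScales β + 1)) (nScales β + 1))).eval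
            (klFermiPoint μ (klFlowFrameU L M β U μ (nScales β + 1)) θ) +
          (klFlowPiece L M β U μ (nScales β)).eval (klFermiPoint μ (klFlowFrameU L M β U μ (nScales β + 1)) θ)) -
        ((symInterp L (klLocSelfEnergyRe L M β U μ (klFlowFrameU L M β U μ (nScales β + 1)) (nScales β + 1))).eval
            (klFermiPoint μ (klFlowFrameU L M β U μ (nScales β)) θ) +
          (klFlowPiece L M β U μ (nScales β)).eval (klFermiPoint μ (klFlowFrameU L M β U μ (nScales β)) θ)))
    (hTr : ∀ k ≤ 4, ∀ θ : ℝ, |iteratedDeriv k (fun θ : ℝ =>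
      ((symInterp L (klLocSelfEnergyRe L M β U μ (klFlowFrameU L M β U μ (nScales β + 1)) (nScales β + 1))).eval
            (klFermiPoint μ (klFlowFrameU L M β U μ (nScales β + 1)) θ) +
          (klFlowPiece L M β U μ (nScales β)).eval (klFermiPoint μ (klFlowFrameU L M β U μ (nScales β + 1)) θ)) -
        ((symInterp L (klLocSelfEnergyRe L M β U μ (klFlowFrameU L M β U μ (nScales β + 1)) (nScales β + 1))).eval
            (klFermiPoint μ (klFlowFrameU L M β U μ (nScales β)) θ) +
          (klFlowPiece L M β U μ (nScales β)).eval (klFermiPoint μ (klFlowFrameU L M β U μ (nScales β)) θ))) θ| ≤ curveJetBar eT eT' U k (nScales β + 1))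
    (hJdiff : ContDiff ℝ 4 fun θ : ℝ => klLocalPart L M β U μ (klFlowFrameU L M β U μ (nScales β)) (nScales β) θ -
      (klFlowPiece L M β U μ (nScales β)).eval (klFermiPoint μ (klFlowFrameU L M β U μ (nScales β + 1)) θ))
    (hJ : ∀ k ≤ 4, ∀ θ : ℝ, |iteratedDeriv k (fun θ : ℝ => klLocalPart L M β U μ (klFlowFrameU L M β U μ (nScales β)) (nScales β) θ -
      (klFlowPiece L M β U μ (nScales β)).eval (klFermiPoint μ (klFlowFrameU L M β U μ (nScales β + 1)) θ)) θ| ≤ curveJetBar eJ eJ' U k (nScales β + 1))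
    (heT0 : eT 0 = 0) (heJ0 : eJ 0 = 0)
    (hfit : ∀ k, cA k + ((if k = 0 then (0 : ℝ) else 1) + eT k + eJ k) ≤ klC4aJetC2 k)
    (hfit' : ∀ k, cA' k + ((if k = 0 then (1 : ℝ) else 0) + eT' k + eJ' k) ≤ klC4aJetC' P R k)
    (hfitO : 2 * (a + (1 + eT' 0 + eJ' 0)) ≤ klReadOscC P R) :
    TwoLegReadJetBound L M klC4aJetC2 (klC4aJetC' P R) β U μ (klFlowFrameU L M β U μ (nScales β + 1)) (nScales β + 1) ∧
      TwoLegReadOscAt L M (klReadOscC P R) β U μ (klFlowFrameU L M β U μ (nScales β + 1)) (nScales β + 1) := by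
  have hP40 : (0 : ℝ) ≤ (1696963596321 + 925 * (10 ^ 14 * (1 + R.Gfr 3 + R.Gfr 4))) := (lastP4_pos hR).le
  -- the three U-rows and the two size rows from the two thresholds and E1's four numbers
  have hZtU := lastResp_hZtU_of_le_klLastRespU (P := P) hR hU.le hUlast
  have hCU := lastResp_hCU_pos_of_le (P := P) hR hU.le hU1 hUlast hcb hcbs hcc hccs (Nb := cb * U) (Nbs := cbs * U) (Nc := cc * U ^ 2) (Ncs := ccs * U ^ 2)
    le_rfl le_rfl le_rfl le_rfl hUE1
  have hZb := lastResp_hZb_of_le (Nb := cb * U) hP40 le_rfl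
  have hZc := lastResp_hZc_of_le (Nc := cc * U ^ 2) hP40 le_rfl
  obtain ⟨hRdiff, hRrows⟩ := lastResponse_bracket_flow_final_pos hR hc hcle hU hU1 hUle hβmin hβc hμ hK hGS hQS hR0 hPh hT hW hΞ hΘ hdoor hL hZn hZtU hCU hs
    (Sb := fun m => cb * U * ((4 : ℝ) ^ nScales β) ^ m) hSb hSbs (Tc := fun m => cc * U ^ 2 * ((4 : ℝ) ^ nScales β) ^ m) hTc hTcs hZb hZc
    (fun j _ => le_rfl) le_rfl (fun j _ => le_rfl) le_rfl
  have e1 : (fun k : ℕ => if k = 0 then (1 : ℝ) else 0) 0 = 1 := if_pos rfl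
  have hfitO' : 2 * (a + ((fun k : ℕ => if k = 0 then (1 : ℝ) else 0) 0 + eT' 0 + eJ' 0)) ≤ klReadOscC P R := by rw [e1]; exact hfitO
  exact twoLegRead_flow_succ_of_swap_lit_registered β U μ hLdeg hA hAval hRdiff hRrows hTrdiff hTr hJdiff hJ (if_pos rfl) heT0 heJ0
    (fun k => hfit k) (fun k => hfit' k) hfitO'

end LastOfPos

end Summit.HubbardSuperconductivity.HubbardSuperconductivity.Theorems.EngineV8

end
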